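import Literature.AlgebraicGeometry.Frobenioids.ArchimedeanFSMIProjectionR
import Literature.AlgebraicGeometry.Frobenioids.ArchimedeanFSMIrreducible
import Literature.AlgebraicGeometry.Frobenioids.ArchimedeanFSMIrreducibleCounterexample
import HarnessLib

/-!
# Frobenioids II, Proposition 3.4 (v), (vi): the instance forms at THE three named towers, by name,
# and the exact base condition for (v)
# (abc-iut cell, block F fact-proving wave, seat f-011, tranche 11: FACT-LIST rows F-0819
# `ArchFrd.Tower.PropV`, F-0823 `ArchFrd.Tower.PropVI_FSMI`, F-0824 `ArchFrd.Tower.PropVI_irreducible`)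

Mochizuki, *The geometry of Frobenioids II: poly-Frobenioids*, Kyushu J. Math. **62** (2008)
401–460, §3, Proposition 3.4 (v), (vi) p. 30 (kurims p. 30 ll. 13–22), proof p. 31 ll. 25–29
[cite: MochizukiFrdII2008, Prop 3.4 (v)(vi) p.30]:

> "(v) Any morphism of `F` that projects to an irreducible morphism (respectively, isomorphism;
> irreducible morphism) of `D`, to an isomorphism (respectively, irreducible morphism; irreducible
> morphism) of `F₀`, and to a(n) isomorphism (respectively, isomorphism; non-isomorphism) of `D₀` is
> an irreducible morphism of `F`. (vi) … In particular, irreducible morphisms of `F` project to either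
> isomorphisms or irreducible morphisms of `D`; FSMI-morphisms of `F` project to either isomorphisms
> or FSMI-morphisms of `D`."

PROOF-ONLY companion of `ArchimedeanFSM.lean` (statements, seat abc-iut-L1-t6; DEFS-FROZEN — imported,
never edited); nothing is defined here and no statement of the paper is retyped or strengthened.

The three rows are PARAMETRISED schemata: predicates of an ABSTRACT tower `T : ArchFrd.Tower π`. Their
universal closures over a free tower binder are false (junk towers over `Fin 2`/`Fin 3`:
`ArchFrd.Tower.not_forall_propV`, `…_propVI_FSMI`, `…_propVI_irreducible`, `ArchimedeanFSMTowerSchema.lean`);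
what print asserts are the INSTANCE FORMS at the three NAMED towers `F = A, N, R`
(`ArchFrd.towerA π`, `towerN π`, `towerR π`). This file records them under the cell's `_holds` naming
(R5: "prove the instance forms the consumers cite"; precedent `prop32i_holds`, `thm64i_frobenioid_holds`):

* **F-0823** `Tower.propVI_FSMI_holds` and **F-0824** `Tower.propVI_irreducible_holds`: the two
  "in particular" clauses of (vi) hold at ALL THREE named towers over EVERY base `π : D ⥤ D₀`, with NO
  hypothesis — the landed theorems `ArchFrd.prop34_vi_fsmi` (seat f-011 gen 0: `ArchimedeanFSMIProjection*.lean`,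
  an FSMI-morphism of `F` projects to a monomorphism of `D`) and `ArchFrd.prop34_vi_irreducible`
  (abc-iut-L1-d3, `ArchimedeanFSMLifting.lean`) BY NAME.
* **F-0819** `Tower.PropV`. Print proves (v) using "since `D` is totally epimorphic, if a composite is an
  isomorphism then so are its factors" (p. 31; [FrdI] §0 p. 16); the typed row binds no hypothesis on `D`.
  Recorded here is the EXACT base condition the second projection pattern needs:
  - `A.propV_of_isoFactors`, `N.…`, `R.…`, `prop34_v_of_isoFactors`: (v) holds at the three named towers
    for every base `D` in which THE FACTORS OF AN INVERTIBLE COMPOSITE ARE INVERTIBLE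
    (`∀ β α, IsIso (β ≫ α) → IsIso α ∧ IsIso β`; strictly weaker than "totally epimorphic", which gives it
    by `ArchFrd.isIso_and_isIso_of_isIso_comp`) — abc-iut-L1-d3's criteria `Tower.propV_of_isIso_criteria`
    with the hypothesis left un-specialised;
  - `towerA_not_propV_of_section`: conversely, over ANY base `π : D ⥤ D₀`, a section–retraction pair
    `s ≫ r = 𝟙 d` of `D` with `s` not invertible at an object `d` lying over `Spec ℝ` makes (v) FAIL at the
    named tower `A` (the arrow `(ζ₂, 𝟙 d)` of the real unit object over `d` — `ζ₂` the Frobenius-degree-`2`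
    isometry, irreducible in `A₀` by `A0.isIrreducibleHom_of_degFr_eq_two` — satisfies the hypotheses of the
    second pattern but factors as `(ζ₂, s) ≫ (𝟙, r)` with neither factor invertible); this generalises
    abc-iut-w4-d092's witness at `D := Type`, `π := const (Spec ℝ)` (`towerA_constReal_not_propV`);
  - hence `towerA_propV_iff_isoFactors_of_real`: over a base all of whose objects lie over `Spec ℝ`,
    `(towerA π).PropV` holds IF AND ONLY IF the factors of invertible composites of `D` are invertible.
  So the instance form of F-0819 is CONDITIONAL on a property of `D` that print's standing hypothesis
  (Ex. 3.3 (i), p. 27 "Let `D` be a connected, totally epimorphic category") implies, and the condition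
  cannot be dropped; no `propV_holds` is declared (the hypothesis-free instance form at tower `A` is false).

A FACT row is an assumption label, not an endorsement; refuted-as-schema ≠ refuted-in-print; typed ≠
proved for anything not in this file; no side is taken on [IUTchIII] Cor. 3.12.
-/

namespace Literature.AlgebraicGeometry.Frobenioids

open CategoryTheory

noncomputable section

namespace ArchFrd

universe v u

variable {D : Type u} [Category.{v} D] (π : D ⥤ D0)

/-! ### F-0823, F-0824: item (vi)'s "in particular" clauses at the three named towers, by name -/

/-- **FACT-LIST row F-0823 `ArchFrd.Tower.PropVI_FSMI` HOLDS at THE printed instances**: for `F = A, N,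
R` over EVERY base `π : D ⥤ D₀`, "FSMI-morphisms of `F` project to either isomorphisms or FSMI-morphisms
of `D`" ([FrdII] Prop. 3.4 (vi), kurims p. 30 ll. 21–22) — seat f-011's `ArchFrd.prop34_vi_fsmi` BY NAME
(fully-qualified type; R5: instance form, the universal closure over an abstract tower being false,
`ArchFrd.Tower.not_forall_propVI_FSMI`). No hypothesis: no item (iii), no complex regime, no total
epimorphicity of `D`. [cite: MochizukiFrdII2008, Prop 3.4 (vi) p.30] -/
theorem Tower.propVI_FSMI_holds :
    Literature.AlgebraicGeometry.Frobenioids.ArchFrd.Tower.PropVI_FSMI (towerA π) ∧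
      Literature.AlgebraicGeometry.Frobenioids.ArchFrd.Tower.PropVI_FSMI (towerN π) ∧
        Literature.AlgebraicGeometry.Frobenioids.ArchFrd.Tower.PropVI_FSMI (towerR π) :=
  prop34_vi_fsmi π

/-- **FACT-LIST row F-0824 `ArchFrd.Tower.PropVI_irreducible` HOLDS at THE printed instances**: for
`F = A, N, R` over EVERY base `π : D ⥤ D₀`, "irreducible morphisms of `F` project to either isomorphisms
or irreducible morphisms of `D`" ([FrdII] Prop. 3.4 (vi), kurims p. 30 ll. 20–21) — abc-iut-L1-d3's
`ArchFrd.prop34_vi_irreducible` BY NAME (fully-qualified type; R5: instance form, the universal closure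
over an abstract tower being false, `ArchFrd.Tower.not_forall_propVI_irreducible`). No hypothesis.
[cite: MochizukiFrdII2008, Prop 3.4 (vi) p.30] -/
theorem Tower.propVI_irreducible_holds :
    Literature.AlgebraicGeometry.Frobenioids.ArchFrd.Tower.PropVI_irreducible (towerA π) ∧
      Literature.AlgebraicGeometry.Frobenioids.ArchFrd.Tower.PropVI_irreducible (towerN π) ∧
        Literature.AlgebraicGeometry.Frobenioids.ArchFrd.Tower.PropVI_irreducible (towerR π) :=
  prop34_vi_irreducible π

/-! ### F-0819: item (v) at the three named towers under the exact base condition -/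

/-- **Prop. 3.4 (v) for `F = A`** over any base `D` in which the factors of an invertible composite are
invertible (the only use print makes of "`D` totally epimorphic" in (v), p. 31 ll. 25–27).
[cite: MochizukiFrdII2008, Prop 3.4 (v) p.30] -/
theorem A.propV_of_isoFactors
    (hD : ∀ ⦃X Y Z : D⦄ (β : X ⟶ Y) (α : Y ⟶ Z), IsIso (β ≫ α) → IsIso α ∧ IsIso β) :
    Literature.AlgebraicGeometry.Frobenioids.ArchFrd.Tower.PropV (towerA π) :=
  (towerA π).propV_of_isIso_criteria (isIso_and_isIso_of_isIso_comp A0.isTotallyEpimorphic') hD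
    (fun _ _ ψ => A.isIso_of_isIso_proj π ψ) (fun _ _ ψ => A.isIso_toD0_of_isIso_base0 π ψ)

/-- **Prop. 3.4 (v) for `F = N`** over any base `D` in which the factors of an invertible composite are
invertible. [cite: MochizukiFrdII2008, Prop 3.4 (v) p.30] -/
theorem N.propV_of_isoFactors
    (hD : ∀ ⦃X Y Z : D⦄ (β : X ⟶ Y) (α : Y ⟶ Z), IsIso (β ≫ α) → IsIso α ∧ IsIso β) :
    Literature.AlgebraicGeometry.Frobenioids.ArchFrd.Tower.PropV (towerN π) :=
  (towerN π).propV_of_isIso_criteria (isIso_and_isIso_of_isIso_comp N0.isTotallyEpimorphic') hD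
    (fun _ _ ψ => N.isIso_of_isIso_proj π ψ) (fun _ _ ψ => N.isIso_toD0_of_isIso_base0 π ψ)

/-- **Prop. 3.4 (v) for `F = R`** over any base `D` in which the factors of an invertible composite are
invertible. [cite: MochizukiFrdII2008, Prop 3.4 (v) p.30] -/
theorem R.propV_of_isoFactors
    (hD : ∀ ⦃X Y Z : D⦄ (β : X ⟶ Y) (α : Y ⟶ Z), IsIso (β ≫ α) → IsIso α ∧ IsIso β) :
    Literature.AlgebraicGeometry.Frobenioids.ArchFrd.Tower.PropV (towerR π) :=
  (towerR π).propV_of_isIso_criteria (isIso_and_isIso_of_isIso_comp R0.isTotallyEpimorphic') hD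
    (fun _ _ ψ => R.isIso_of_isIso_proj π ψ) (fun _ _ ψ => R.isIso_toD0_of_isIso_base0 π ψ)

/-- **FACT-LIST row F-0819 `ArchFrd.Tower.PropV` at THE printed instances, CONDITIONAL form**: for
`F = A, N, R` over every base `D` in which the factors of an invertible composite are invertible — in
particular over every totally epimorphic `D` (Ex. 3.3 (i), p. 27; `prop34_v_of_isTotallyEpimorphic`).
The condition cannot be dropped: `towerA_not_propV_of_section`. [cite: MochizukiFrdII2008, Prop 3.4 (v) p.30] -/
theorem prop34_v_of_isoFactors
    (hD : ∀ ⦃X Y Z : D⦄ (β : X ⟶ Y) (α : Y ⟶ Z), IsIso (β ≫ α) → IsIso α ∧ IsIso β) :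
    Literature.AlgebraicGeometry.Frobenioids.ArchFrd.Prop34_v π :=
  ⟨A.propV_of_isoFactors π hD, N.propV_of_isoFactors π hD, R.propV_of_isoFactors π hD⟩

/-! ### F-0819: the base condition is necessary (tower `A`, objects over `Spec ℝ`) -/

/-- Every arrow of `D₀` out of `Spec ℝ` is an isomorphism (its codomain is `Spec ℝ` — there is no arrow
`Spec ℝ → Spec ℂ` — and `Hom(Spec ℝ, Spec ℝ) = {id}`). [cite: MochizukiFrdII2008, §3 p.23] -/
theorem D0.isIso_of_real_dom {K : D0} (f : D0.real ⟶ K) : IsIso f := by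
  cases K with
  | real => rw [D0.hom_real_real_eq_id f]; infer_instance
  | complex => exact (D0.isEmpty_hom_real_complex.false f).elim

/-- **Prop. 3.4 (v) FAILS at the named tower `A` over ANY base admitting a non-invertible section at an
object over `Spec ℝ`**: if `s : d ⟶ e`, `r : e ⟶ d` in `D` satisfy `s ≫ r = 𝟙 d` with `s` not an
isomorphism and `π(d) ≅ Spec ℝ`, then the arrow `φ = (ζ₂, 𝟙 d)` of the real unit object
`((Spec ℝ, [0,1]), d)` of `A` projects to the isomorphism `𝟙 d` of `D`, to the IRREDUCIBLE arrow `ζ₂`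
(Frobenius degree `2`, `A0.isIrreducibleHom_of_degFr_eq_two`) of `A₀` and to an isomorphism of `D₀`, yet
`φ = (𝟙, r) ∘ (ζ₂, s)` with neither factor invertible — so the second projection pattern of (v) fails.
Generalises abc-iut-w4-d092's `towerA_constReal_not_propV` (`D := Type`, `s := (· + 1)`, `r := (· - 1)`
on `ℕ`). [cite: MochizukiFrdII2008, Prop 3.4 (v) p.30] -/
theorem towerA_not_propV_of_section {d e : D} (s : d ⟶ e) (r : e ⟶ d) (hsr : s ≫ r = 𝟙 d)
    (hs : ¬ IsIso s) (ι : D0.real ≅ π.obj d) :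
    ¬ Literature.AlgebraicGeometry.Frobenioids.ArchFrd.Tower.PropV (towerA π) := by
  intro h
  have hX0 : (C0.realOfTip 1).IsNaivelyIsotropic := C0.isNaivelyIsotropic_of_isRealObj rfl
  -- the identification over `e`: `Spec ℝ ≅ π(d) → π(e)` is invertible (every arrow out of `Spec ℝ` is)
  haveI : IsIso (ι.hom ≫ π.map s) := D0.isIso_of_real_dom _
  let ι' : D0.real ≅ π.obj e := asIso (ι.hom ≫ π.map s)
  let Xc : C π := ⟨C0.realOfTip 1, d, ι⟩
  let Ec : C π := ⟨C0.realOfTip 1, e, ι'⟩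
  let X : A π := ⟨Xc⟩
  let E : A π := ⟨Ec⟩
  let f0 : C0.realOfTip 1 ⟶ C0.realOfTip 1 := C0.frobEndo hX0 2
  have hf0 : PreFrobenioid.IsIsometry C0.toElem f0 := C0.isIsometry_frobEndo hX0 2
  -- the compatibility squares all live in `Hom(Spec ℝ, −)`, a subsingleton
  have hwXX : ∀ (g0 : C0.realOfTip 1 ⟶ C0.realOfTip 1) (g : d ⟶ d),
      (PreFrobenioid.baseFunctor C0.toElem).map g0 ≫ Xc.iso.hom = Xc.iso.hom ≫ π.map g :=
    fun g0 g => Subsingleton.elim (α := D0.real ⟶ π.obj d) _ _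
  have hwXE : ∀ (g0 : C0.realOfTip 1 ⟶ C0.realOfTip 1) (g : d ⟶ e),
      (PreFrobenioid.baseFunctor C0.toElem).map g0 ≫ Ec.iso.hom = Xc.iso.hom ≫ π.map g :=
    fun g0 g => Subsingleton.elim (α := D0.real ⟶ π.obj e) _ _
  have hwEX : ∀ (g0 : C0.realOfTip 1 ⟶ C0.realOfTip 1) (g : e ⟶ d),
      (PreFrobenioid.baseFunctor C0.toElem).map g0 ≫ Xc.iso.hom = Ec.iso.hom ≫ π.map g :=
    fun g0 g => Subsingleton.elim (α := D0.real ⟶ π.obj d) _ _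
  -- isometries of `C = C₀ ×_{D₀} D` are detected on the `C₀`-component
  have hisomXX : ∀ {g0 : C0.realOfTip 1 ⟶ C0.realOfTip 1} (g : d ⟶ d),
      PreFrobenioid.IsIsometry C0.toElem g0 →
      PreFrobenioid.isometricMorphisms (C.toElem π) (⟨g0, g, hwXX g0 g⟩ : Xc ⟶ Xc) := by
    intro g0 g hg0
    change pull _ _ (PreFrobenioid.Div C0.toElem g0) = 1
    rw [show PreFrobenioid.Div C0.toElem g0 = 1 from hg0, map_one]
  have hisomXE : ∀ {g0 : C0.realOfTip 1 ⟶ C0.realOfTip 1} (g : d ⟶ e),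
      PreFrobenioid.IsIsometry C0.toElem g0 →
      PreFrobenioid.isometricMorphisms (C.toElem π) (⟨g0, g, hwXE g0 g⟩ : Xc ⟶ Ec) := by
    intro g0 g hg0
    change pull _ _ (PreFrobenioid.Div C0.toElem g0) = 1
    rw [show PreFrobenioid.Div C0.toElem g0 = 1 from hg0, map_one]
  have hisomEX : ∀ {g0 : C0.realOfTip 1 ⟶ C0.realOfTip 1} (g : e ⟶ d),
      PreFrobenioid.IsIsometry C0.toElem g0 →
      PreFrobenioid.isometricMorphisms (C.toElem π) (⟨g0, g, hwEX g0 g⟩ : Ec ⟶ Xc) := by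
    intro g0 g hg0
    change pull _ _ (PreFrobenioid.Div C0.toElem g0) = 1
    rw [show PreFrobenioid.Div C0.toElem g0 = 1 from hg0, map_one]
  let φ : X ⟶ X := ⟨⟨f0, 𝟙 d, hwXX _ _⟩, hisomXX _ hf0⟩
  let β : X ⟶ E := ⟨⟨f0, s, hwXE _ _⟩, hisomXE _ hf0⟩
  let α : E ⟶ X := ⟨⟨𝟙 _, r, hwEX _ _⟩, hisomEX _ (PreFrobenioid.div_id C0.toElem _)⟩
  have hfac : β ≫ α = φ :=
    WideSubcategory.hom_ext _ (CFP.hom_ext (Category.comp_id f0) hsr)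
  -- the second projection pattern of (v) applied to `φ`
  have hirr : IsIrreducibleHom φ :=
    (h φ).2.1 (by change IsIso (𝟙 d); infer_instance)
      (A0.isIrreducibleHom_of_degFr_eq_two _ rfl)
      (by change IsIso (π.map (𝟙 d)); rw [π.map_id]; infer_instance)
  rcases hirr.2 β α hfac with hα | hβ
  · -- `α` invertible ⇒ `r` invertible ⇒ `s = r⁻¹` invertible
    have hαC : IsIso α.hom := by haveI := hα; exact PreFrobenioid.Isometries.isIso_val α
    haveI hr : IsIso r := by haveI := hαC; exact CFP.isIso_snd α.hom
    have hs' : s = inv r := by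
      rw [← Category.comp_id s, ← IsIso.hom_inv_id r, ← Category.assoc, hsr, Category.id_comp]
    exact hs (by rw [hs']; infer_instance)
  · -- `β` invertible ⇒ `s` invertible
    have hβC : IsIso β.hom := by haveI := hβ; exact PreFrobenioid.Isometries.isIso_val β
    exact hs (by haveI := hβC; exact CFP.isIso_snd β.hom)

/-- **Exact base condition for Prop. 3.4 (v) at the named tower `A`, over bases lying over `Spec ℝ`**:
if every object of `D` lies over `Spec ℝ`, then `(towerA π).PropV` holds IF AND ONLY IF the factors of
every invertible composite of `D` are invertible (sufficiency: `A.propV_of_isoFactors`; necessity: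
`towerA_not_propV_of_section` applied to the section `β` with retraction `α ≫ (β ≫ α)⁻¹`).
[cite: MochizukiFrdII2008, Prop 3.4 (v) p.30] -/
theorem towerA_propV_iff_isoFactors_of_real (hπ : ∀ d : D, π.obj d = D0.real) :
    Literature.AlgebraicGeometry.Frobenioids.ArchFrd.Tower.PropV (towerA π) ↔
      ∀ ⦃X Y Z : D⦄ (β : X ⟶ Y) (α : Y ⟶ Z), IsIso (β ≫ α) → IsIso α ∧ IsIso β := by
  refine ⟨fun h X Y Z β α hβα => ?_, A.propV_of_isoFactors π⟩
  haveI := hβα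
  by_cases hβ : IsIso β
  · refine ⟨?_, hβ⟩
    have hα : α = inv β ≫ (β ≫ α) := by rw [IsIso.inv_hom_id_assoc]
    rw [hα]
    infer_instance
  · exact (towerA_not_propV_of_section π β (α ≫ inv (β ≫ α))
      (by rw [← Category.assoc, IsIso.hom_inv_id]) hβ (eqToIso (hπ X).symm) h).elim

/-- **The typed row over the constant real base, exact form**: for ANY category `D`, Prop. 3.4 (v) holds at
the named tower `A` over `π := const (Spec ℝ)` iff the factors of invertible composites of `D` are
invertible; abc-iut-w4-d092's `towerA_constReal_not_propV` is the instance `D := Type`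
(`(· + 1) ≫ (· - 1) = 𝟙 ℕ`). [cite: MochizukiFrdII2008, Prop 3.4 (v) p.30] -/
theorem towerA_constReal_propV_iff (D : Type u) [Category.{v} D] :
    Literature.AlgebraicGeometry.Frobenioids.ArchFrd.Tower.PropV
        (towerA ((Functor.const D).obj D0.real)) ↔
      ∀ ⦃X Y Z : D⦄ (β : X ⟶ Y) (α : Y ⟶ Z), IsIso (β ≫ α) → IsIso α ∧ IsIso β :=
  towerA_propV_iff_isoFactors_of_real ((Functor.const D).obj D0.real) fun _ => rfl

end ArchFrd

end

end Literature.AlgebraicGeometry.Frobenioids
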